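import Summits.HodgeConjecture.HodgeConjecture.Theorems.F0P3bArchDegOnePackageDefs
import Summits.HodgeConjecture.HodgeConjecture.Theorems.F0P3bStubT6eCasimirScalar
import Summits.HodgeConjecture.HodgeConjecture.Theorems.F0P3bStubT3jCocycleValuesPNull
import Summits.HodgeConjecture.HodgeConjecture.Theorems.F0P3bStubT6dAdmissibleBridge
import Summits.HodgeConjecture.HodgeConjecture.Theorems.F0P3bStubT6kU21PGeometry
import Summits.HodgeConjecture.HodgeConjecture.Theorems.F0P3bStubT6gPNullGeneration
import Summits.HodgeConjecture.HodgeConjecture.Theorems.F0P3bStubT6rPNullRigidity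
import HarnessLib

/-!
# FLOOR-0 P3b «ENGINE local packets» — the archimedean `T6` package PROVED, THEOREMS-SIDE (floor-importable)

Cell hodgecm-mathlib (D-0151), FLOOR 0, crux item H413 = stmt-HodgeConjecture-24833; twin of the crux workfile
`Cruxes/H413/Lines/F0_EngineLocalPackets.lean` ed. 2.x (F0P3b-plan (g3) 23:33Z O3: «ONE floor-importable twin … over the ★
closers BY NAME, sorries 0»; split in two by the 400-line ∕ defs-file rules: definitions in ★
`F0P3bArchDegOnePackageDefs`, proofs here).  Author F0P3-p04 (g2).  CONTENT: the six registered ∕ folded stubs T6d, T3j,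
T6e (generic door-openers), T6g, T6r (generic engine), T6k (`U(2,1)` geometry) are theorems BY NAME of their ★ closers
(A-p12, A-p09, A-p09, F0P3-p01, F0P3-p03, F0P3-p04); T6a (purity), T6b (`dim_ℝ H¹_δ ≤ 2`), T6c (rigidity) for `U(2,1)`
are DERIVED (`t6a_of`, `t6b_of`, `t6c_of`, `typeOne_eq_smul_of` — the workfile's kernel-checked compositions, VERBATIM);
the package `archDegOnePackage_holds : ArchDegOnePackage` and its consumers `cochainsFinite_of_T6d` (BW II 3.4 (1)),
`not_both_types_of_T6a` (E2′-shaped), `holType_equivalent_of_T6c` (E1′-shaped), `finrank_H1_le_two_of` (Rogawski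
15.2.1 (b), dimension clause) follow.  No unitarity ∕ admissibility ∕ classification of the unitary dual is used for
T6a∕b∕c (the defs keep those hypotheses; the proofs do not use them).
[cite: Rogawski1990, Prop. 15.2.1 (b)] [cite: BorelWallach2000, II §4.1–4.2, II Prop. 3.4 (1), VI Thm. 4.11] [cite: VoganZuckerman1984, Thm. 5.6]

HONEST LABEL: HC_CM is proved only modulo the printed citations until rung 0 closes; this file discharges none of them.
-/

set_option autoImplicit false
set_option linter.dupNamespace false

noncomputable section

open scoped TensorProduct

namespace Summit.HodgeConjecture.HodgeConjecture.Cruxes.H413.F0P3bArchDegOnePackage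

open Literature.Algebra.Lie Literature.Algebra.Lie.ChevalleyEilenberg
open Literature.NumberTheory.Automorphic
open Literature.RepresentationTheory.BorelWallach2000
open Literature.RepresentationTheory.KonnoKonno2007 Literature.RepresentationTheory.KonnoKonno2007.RealDualPair
open Literature.RepresentationTheory.KonnoKonno2007.RealDualPair.UForm

-- Mathlib idiom (as in `GKModules`, `GKCohomology`, the `Upq*` files): commutator bracket on `Module.End`
attribute [local instance 100] LieRing.ofAssociativeRing

-- glue REUSED BY NAME from the ★ closers' modules (gate dedup): same statements as the workfile's §2′ copies
open Summit.HodgeConjecture.HodgeConjecture.Cruxes.H413.F0P3bStubT6kU21PGeometry (cochainOne_eq_zero cochainOne_apply_add)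
open Summit.HodgeConjecture.HodgeConjecture.Cruxes.H413.F0P3bStubT6kU21PGeometry renaming
  apply_eq_zero_of_mem_kInLie → gkOne_apply_of_mem_kInLie
open Summit.HodgeConjecture.HodgeConjecture.Cruxes.H413.F0P3bGKPairGlue (cochainOne_exists_apply_ne_zero)

/-! ## §1 Glue lemmas on `(𝔤, K)`-1-cochains of `U(α, β)` (VERBATIM from the workfile §2′; universe-`0` carriers, as
every stub quantifies `(α β V : Type)`) -/

section Glue

variable {α β : Type} [Fintype α] [DecidableEq α] [Fintype β] [DecidableEq β]
  {V : Type} [AddCommGroup V] [Module ℂ V]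
  (ρK : Representation ℂ (uFormGroup α β).maximalCompact V)
  (ρ𝔤 : (uFormGroup α β).lie →ₗ⁅ℝ⁆ Module.End ℂ V)
  (hV : ∀ (k : (uFormGroup α β).maximalCompact) (X : (uFormGroup α β).lie), ρK k ∘ₗ ρ𝔤 X ∘ₗ ρK k⁻¹ =
    ρ𝔤 ((uFormGroup α β).Ad (Subgroup.inclusion (uFormGroup α β).maximalCompact_le_carrier k) X))

/-- A non-zero class of type `δ` is represented by a non-zero COCYCLE of type `δ`. [cite: BorelWallach2000, II Thm. 4.8] -/
theorem exists_typeCocycle_of_ne_bot {δ : ℤ} (h : upqTypeClasses ρK ρ𝔤 hV 1 δ ≠ ⊥) :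
    ∃ f : Cochain ℝ (uFormGroup α β).lie (GKCarrier (uFormGroup α β) ρ𝔤) 1,
      f ∈ upqType ρK ρ𝔤 hV 1 δ ∧ d ℝ (uFormGroup α β).lie (GKCarrier (uFormGroup α β) ρ𝔤) 1 f = 0 ∧ f ≠ 0 := by
  obtain ⟨x, hx, hx0⟩ := (Submodule.ne_bot_iff _).1 h
  obtain ⟨z, hz, rfl⟩ := hx
  have hzt : (z : Cochain ℝ (uFormGroup α β).lie (GKCarrier (uFormGroup α β) ρ𝔤) 1) ∈ upqType ρK ρ𝔤 hV 1 δ :=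
    Submodule.mem_comap.1 hz
  have hzc := ((gkComplex (uFormGroup α β) ρK ρ𝔤 hV).mem_cocycles_iff 1 _).1 z.2
  refine ⟨z, hzt, hzc.2, fun hz0 => hx0 ?_⟩
  have : z = 0 := Subtype.ext hz0
  rw [this, map_zero]

/-- `𝔨`-equivariance of a `(𝔤, K)`-1-cochain: `f(⁅Y, X⁆) = ρ𝔤(Y) f(X)`, `Y ∈ 𝔨`. [cite: BorelWallach2000, I §5.1 (2)] -/
theorem gkOne_apply_lie {f : Cochain ℝ (uFormGroup α β).lie (GKCarrier (uFormGroup α β) ρ𝔤) 1}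
    (hf : f ∈ (gkComplex (uFormGroup α β) ρK ρ𝔤 hV).carrier 1) {Y : (uFormGroup α β).lie}
    (hY : Y ∈ (uFormGroup α β).kInLie) (X : (uFormGroup α β).lie) : f ![⁅Y, X⁆] = ρ𝔤 Y (f ![X]) := by
  have h : lieDer ℝ (uFormGroup α β).lie (GKCarrier (uFormGroup α β) ρ𝔤) 1 Y f = 0 :=
    (((mem_gkComplex_succ_iff (uFormGroup α β) ρK ρ𝔤 hV 0 f).1 hf).1 Y hY).1
  have e := congrArg (fun g : Cochain ℝ (uFormGroup α β).lie (GKCarrier (uFormGroup α β) ρ𝔤) 1 => g ![X]) h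
  simp only [lieDer_one_apply, AlternatingMap.zero_apply, sub_eq_zero] at e
  rw [GKCarrier.bracket_def] at e
  exact e.symm

/-- Degree-one types are `±1` only: a type-`δ` `(𝔤, K)`-1-cochain with `δ² ≠ 1` vanishes. [cite: BorelWallach2000, II §4.2 (3)] -/
theorem typeOne_eq_zero_of_sq_ne_one {δ : ℤ} (hδ : δ * δ ≠ 1)
    {f : Cochain ℝ (uFormGroup α β).lie (GKCarrier (uFormGroup α β) ρ𝔤) 1} (hf : f ∈ upqType ρK ρ𝔤 hV 1 δ) :
    f = 0 := by
  obtain ⟨hfc, hft⟩ := (mem_upqType_iff ρK ρ𝔤 hV 1 δ f).1 hf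
  refine cochainOne_eq_zero ρ𝔤 fun X => ?_
  have hJ : ∀ Y : (uFormGroup α β).lie, f ![⁅upqZ0 α β, Y⁆] = ((δ : ℂ) * Complex.I) • f ![Y] := fun Y => by
    rw [gkOne_apply_lie ρK ρ𝔤 hV hfc upqZ0_mem_kInLie Y]
    exact hft ![Y]
  have h0 : f ![⁅upqZ0 α β, ⁅upqZ0 α β, X⁆⁆ + X] = 0 :=
    gkOne_apply_of_mem_kInLie ρK ρ𝔤 hV hfc (upq_isComplexStructureElement.lie_lie_add_mem X)
  rw [cochainOne_apply_add ρ𝔤, hJ, hJ, smul_smul] at h0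
  have hI : ((δ : ℂ) * Complex.I) * ((δ : ℂ) * Complex.I) = -((δ * δ : ℤ) : ℂ) := by
    rw [show ((δ : ℂ) * Complex.I) * ((δ : ℂ) * Complex.I) = (δ : ℂ) * (δ : ℂ) * (Complex.I * Complex.I) by ring,
      Complex.I_mul_I]
    push_cast
    ring
  rw [hI, neg_smul, neg_add_eq_sub, sub_eq_zero] at h0
  -- h0 : f ![X] = ((δ * δ : ℤ) : ℂ) • f ![X]
  have h1 : ((1 : ℂ) - ((δ * δ : ℤ) : ℂ)) • f ![X] = 0 := by
    rw [sub_smul, one_smul, ← h0, sub_self]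
  have hne : (1 : ℂ) - ((δ * δ : ℤ) : ℂ) ≠ 0 := by
    rw [sub_ne_zero]
    intro h1
    apply hδ
    exact_mod_cast h1.symm
  exact (smul_eq_zero.1 h1).resolve_left hne

end Glue

/-! ## §2 The six registered ∕ folded stubs as theorems BY NAME of their ★ closers -/

section Folds

/-- ★ StubT6dAdmissibleBridge holds — by-name fold of the ★ closer `F0P3bStubT6dAdmissibleBridge.stubT6d_holds` (its type is the def body, binder for binder). [cite: BorelWallach2000, 0 §2.4–2.5, II Prop. 3.4 (1)] -/
theorem stub_T6d_admissibleBridge : StubT6dAdmissibleBridge :=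
  F0P3bStubT6dAdmissibleBridge.stubT6d_holds

/-- ★ StubT3jCocycleValuesPNull holds — by-name fold of the ★ closer `F0P3bStubT3jCocycleValuesPNull.stubT3j_holds` (its type is the def body, binder for binder). [cite: BorelWallach2000, II §4.2 (3)] -/
theorem stub_T3j_cocycleValuesPNull : StubT3jCocycleValuesPNull :=
  F0P3bStubT3jCocycleValuesPNull.stubT3j_holds

/-- ★ StubT6eCasimirScalar holds — by-name fold of the ★ closer `F0P3bStubT6eCasimirScalar.stubT6e_holds` (its type is the def body, binder for binder). [cite: BorelWallach2000, II §3.1, Cor. 3.3] -/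
theorem stub_T6e_casimirScalar : StubT6eCasimirScalar :=
  F0P3bStubT6eCasimirScalar.stubT6e_holds

/-- ★ StubT6kU21PGeometry holds — by-name fold of the ★ closer `F0P3bStubT6kU21PGeometry.stubT6k_holds` (its type is the def body, binder for binder). [cite: BorelWallach2000, II §4.1–4.2] -/
theorem stub_T6k_u21PGeometry : StubT6kU21PGeometry :=
  F0P3bStubT6kU21PGeometry.stubT6k_holds

/-- ★ StubT6gPNullGeneration holds — by-name fold of the ★ closer `F0P3bStubT6gPNullGeneration.stubT6g_holds` (its type is the def body, binder for binder). [cite: BorelWallach2000, II §4.1, VI Thm. 4.11] -/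
theorem stub_T6g_pNullGeneration : StubT6gPNullGeneration :=
  F0P3bStubT6gPNullGeneration.stubT6g_holds

/-- ★ StubT6rPNullRigidity holds — by-name fold of the ★ closer `F0P3bStubT6rPNullRigidity.stubT6r_holds` (its type is the def body, binder for binder). [cite: BorelWallach2000, VI Thm. 4.11 (1)] -/
theorem stub_T6r_pNullRigidity : StubT6rPNullRigidity :=
  F0P3bStubT6rPNullRigidity.stubT6r_holds

end Folds

/-! ## §3 T6a ∕ T6b ∕ T6c for `U(2,1)`, DERIVED (the workfile's kernel-checked compositions, VERBATIM) -/

section T6abc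

/-- **T6a from T3j + T6g** (kernel-checked composition). [cite: BorelWallach2000, VI Thm. 4.11 (9),(11)] -/
theorem t6a_of (h3j : StubT3jCocycleValuesPNull) (h6g : StubT6gPNullGeneration) : StubT6aDegOneTypePure := by
  intro V _ _ ρK ρ𝔤 h
  by_contra hboth
  obtain ⟨hp, hm⟩ := not_or.1 hboth
  obtain ⟨f, hf, hdf, hf0⟩ := exists_typeCocycle_of_ne_bot ρK ρ𝔤 h.gk.ad_compat hp
  obtain ⟨g, hg, -, hg0⟩ := exists_typeCocycle_of_ne_bot ρK ρ𝔤 h.gk.ad_compat hm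
  have hfN := h3j (Fin 2) (Fin 1) V ρK ρ𝔤 h.gk.ad_compat 1 (by norm_num) f hf hdf
  obtain ⟨hspec, -⟩ := h6g (Fin 2) (Fin 1) V ρK ρ𝔤 h.gk.ad_compat h.irred 1 (Or.inl rfl) f hf hf0 hfN
  obtain ⟨X, hX⟩ := cochainOne_exists_apply_ne_zero ρ𝔤 hg0
  have hev := ((mem_upqType_iff ρK ρ𝔤 h.gk.ad_compat 1 (-1) g).1 hg).2 ![X]
  obtain ⟨k, hk⟩ := hspec _ (g ![X]) hX hev
  have hk' : ((-1 : ℤ) : ℂ) = (((1 : ℤ) * ((k : ℤ) + 1) : ℤ) : ℂ) := mul_right_cancel₀ Complex.I_ne_zero hk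
  have hk'' : (-1 : ℤ) = 1 * ((k : ℤ) + 1) := by exact_mod_cast hk'
  omega

/-- **T6c from T3j + T6k (1) + T6r** (kernel-checked composition). [cite: BorelWallach2000, VI Thm. 4.11 (1)] -/
theorem t6c_of (h3j : StubT3jCocycleValuesPNull) (h6k : StubT6kU21PGeometry) (h6r : StubT6rPNullRigidity) :
    StubT6cDegOneTypeRigid := by
  intro V _ _ ρK ρ𝔤 h V' _ _ ρK' ρ𝔤' h' δ hδ hne hne'
  have hδ2 : δ * δ = 1 := by rcases hδ with rfl | rfl <;> norm_num
  obtain ⟨f, hf, hdf, hf0⟩ := exists_typeCocycle_of_ne_bot ρK ρ𝔤 h.gk.ad_compat hne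
  obtain ⟨f', hf', hdf', hf0'⟩ := exists_typeCocycle_of_ne_bot ρK' ρ𝔤' h'.gk.ad_compat hne'
  have hN := h3j (Fin 2) (Fin 1) V ρK ρ𝔤 h.gk.ad_compat δ hδ2 f hf hdf
  have hN' := h3j (Fin 2) (Fin 1) V' ρK' ρ𝔤' h'.gk.ad_compat δ hδ2 f' hf' hdf'
  have hk := (h6k V ρK ρ𝔤 h.gk.ad_compat δ hδ f f hf hf hf0).1
  have hk' := (h6k V' ρK' ρ𝔤' h'.gk.ad_compat δ hδ f' f' hf' hf' hf0').1
  exact h6r (Fin 2) (Fin 1) V ρK ρ𝔤 h.gk.ad_compat V' ρK' ρ𝔤' h'.gk.ad_compat h.irred h'.irred δ hδ f f' hf hf'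
    hf0 hf0' hN hN' fun X => (hk X).trans (hk' X).symm

/-- **One complex line of type-`δ` cochains** (`U(2,1)`, `δ = ±1`): given a non-zero CLOSED type-`δ` cochain `f₀`
of an irreducible `V`, every type-`δ` `(𝔤, K)`-1-cochain is a complex multiple of `f₀` — T3j (values of `f₀` are
`𝔭^{−δ}`-null) + T6g (2) (the `δ i`-eigenvectors of `z₀` lie in `span_ℂ f₀(𝔤)`) + T6k (2) (Schur).
[cite: BorelWallach2000, VI Thm. 4.11 (3)] -/
theorem typeOne_eq_smul_of (h3j : StubT3jCocycleValuesPNull) (h6g : StubT6gPNullGeneration)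
    (h6k : StubT6kU21PGeometry) {V : Type} [AddCommGroup V] [Module ℂ V]
    (ρK : Representation ℂ (uFormGroup (Fin 2) (Fin 1)).maximalCompact V)
    (ρ𝔤 : (uFormGroup (Fin 2) (Fin 1)).lie →ₗ⁅ℝ⁆ Module.End ℂ V) (h : IsCohUnitaryIrrep ρK ρ𝔤)
    {δ : ℤ} (hδ : δ = 1 ∨ δ = -1)
    {f₀ : Cochain ℝ (uFormGroup (Fin 2) (Fin 1)).lie (GKCarrier (uFormGroup (Fin 2) (Fin 1)) ρ𝔤) 1}
    (hf₀t : f₀ ∈ upqType ρK ρ𝔤 h.gk.ad_compat 1 δ)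
    (hd₀ : d ℝ (uFormGroup (Fin 2) (Fin 1)).lie (GKCarrier (uFormGroup (Fin 2) (Fin 1)) ρ𝔤) 1 f₀ = 0) (hf₀0 : f₀ ≠ 0)
    {g : Cochain ℝ (uFormGroup (Fin 2) (Fin 1)).lie (GKCarrier (uFormGroup (Fin 2) (Fin 1)) ρ𝔤) 1}
    (hgt : g ∈ upqType ρK ρ𝔤 h.gk.ad_compat 1 δ) : ∃ c : ℂ, g = c • f₀ := by
  have hδ2 : δ * δ = 1 := by rcases hδ with rfl | rfl <;> norm_num
  have hN := h3j (Fin 2) (Fin 1) V ρK ρ𝔤 h.gk.ad_compat δ hδ2 f₀ hf₀t hd₀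
  obtain ⟨-, hW⟩ := h6g (Fin 2) (Fin 1) V ρK ρ𝔤 h.gk.ad_compat h.irred δ hδ f₀ hf₀t hf₀0 hN
  have hgv := ((mem_upqType_iff ρK ρ𝔤 h.gk.ad_compat 1 δ g).1 hgt).2
  have hvals : ∀ X : (uFormGroup (Fin 2) (Fin 1)).lie,
      g ![X] ∈ Submodule.span ℂ (Set.range fun Y : (uFormGroup (Fin 2) (Fin 1)).lie => f₀ ![Y]) :=
    fun X => hW (g ![X]) (hgv ![X])
  obtain ⟨c, hc⟩ := (h6k V ρK ρ𝔤 h.gk.ad_compat δ hδ f₀ g hf₀t hgt hf₀0).2 hvals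
  refine ⟨c, sub_eq_zero.1 (cochainOne_eq_zero ρ𝔤 fun X => ?_)⟩
  rw [AlternatingMap.sub_apply, AlternatingMap.smul_apply, hc X, sub_self]

/-- **T6b from T3j + T6g (2) + T6k (2)** (kernel-checked composition): the type-`δ` cocycles `Z¹_δ` sit in the real
plane `ℂ • f₀` (or vanish: `δ² ≠ 1`, or no non-zero cocycle), hence so do their classes `H¹_δ = [Z¹_δ]`.
[cite: BorelWallach2000, VI Thm. 4.11 (3)] -/
theorem t6b_of (h3j : StubT3jCocycleValuesPNull) (h6g : StubT6gPNullGeneration) (h6k : StubT6kU21PGeometry) :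
    StubT6bDegOneTypeFinrank := by
  intro V _ _ ρK ρ𝔤 h δ
  -- `Z = Z¹_δ ≤ Z¹` (an `ℝ`-submodule of the cocycles); `H¹_δ = Z.map [·]` by definition of `upqTypeClasses`
  obtain ⟨Z, hZ⟩ : ∃ Z : Submodule ℝ ↥((gkComplex (uFormGroup (Fin 2) (Fin 1)) ρK ρ𝔤 h.gk.ad_compat).cocycles 1),
      Z = (upqType ρK ρ𝔤 h.gk.ad_compat 1 δ).comap ((gkComplex (uFormGroup (Fin 2) (Fin 1)) ρK ρ𝔤 h.gk.ad_compat).cocycles 1).subtype := ⟨_, rfl⟩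
  have hcl : upqTypeClasses ρK ρ𝔤 h.gk.ad_compat 1 δ = Z.map ((gkComplex (uFormGroup (Fin 2) (Fin 1)) ρK ρ𝔤 h.gk.ad_compat).toCohomology 1) := by
    rw [hZ]
    rfl
  have hmemZ : ∀ z : ↥((gkComplex (uFormGroup (Fin 2) (Fin 1)) ρK ρ𝔤 h.gk.ad_compat).cocycles 1), z ∈ Z ↔ (z : Cochain ℝ (uFormGroup (Fin 2) (Fin 1)).lie (GKCarrier (uFormGroup (Fin 2) (Fin 1)) ρ𝔤) 1) ∈ upqType ρK ρ𝔤 h.gk.ad_compat 1 δ := fun z => by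
    rw [hZ, Submodule.mem_comap, Submodule.coe_subtype]
  rw [hcl]
  suffices hfin : Module.Finite ℝ ↥Z ∧ Module.finrank ℝ ↥Z ≤ 2 by
    haveI := hfin.1
    exact ⟨Module.Finite.of_surjective (((gkComplex (uFormGroup (Fin 2) (Fin 1)) ρK ρ𝔤 h.gk.ad_compat).toCohomology 1).submoduleMap Z)
        (LinearMap.submoduleMap_surjective _ Z), (Submodule.finrank_map_le _ Z).trans hfin.2⟩
  by_cases hex : ∃ z ∈ Z, (z : Cochain ℝ (uFormGroup (Fin 2) (Fin 1)).lie (GKCarrier (uFormGroup (Fin 2) (Fin 1)) ρ𝔤) 1) ≠ 0 ∧ (δ = 1 ∨ δ = -1)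
  · obtain ⟨z₀, hz₀, hz₀0, hδ⟩ := hex
    have hf₀t : (z₀ : Cochain ℝ (uFormGroup (Fin 2) (Fin 1)).lie (GKCarrier (uFormGroup (Fin 2) (Fin 1)) ρ𝔤) 1) ∈ upqType ρK ρ𝔤 h.gk.ad_compat 1 δ := (hmemZ z₀).1 hz₀
    have hd₀ : d ℝ (uFormGroup (Fin 2) (Fin 1)).lie (GKCarrier (uFormGroup (Fin 2) (Fin 1)) ρ𝔤) 1 (z₀ : Cochain ℝ (uFormGroup (Fin 2) (Fin 1)).lie (GKCarrier (uFormGroup (Fin 2) (Fin 1)) ρ𝔤) 1) = 0 :=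
      (((gkComplex (uFormGroup (Fin 2) (Fin 1)) ρK ρ𝔤 h.gk.ad_compat).mem_cocycles_iff 1 _).1 z₀.2).2
    -- the real plane `ℂ • f₀ ⊆ C¹` as the range of an `ℝ`-linear map `ℂ → C¹`
    let Φ : ℂ →ₗ[ℝ] Cochain ℝ (uFormGroup (Fin 2) (Fin 1)).lie (GKCarrier (uFormGroup (Fin 2) (Fin 1)) ρ𝔤) 1 :=
      (LinearMap.toSpanSingleton ℂ (Cochain ℝ (uFormGroup (Fin 2) (Fin 1)).lie (GKCarrier (uFormGroup (Fin 2) (Fin 1)) ρ𝔤) 1) (z₀ : Cochain ℝ (uFormGroup (Fin 2) (Fin 1)).lie (GKCarrier (uFormGroup (Fin 2) (Fin 1)) ρ𝔤) 1)).restrictScalars ℝ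
    have hle : Z.map ((gkComplex (uFormGroup (Fin 2) (Fin 1)) ρK ρ𝔤 h.gk.ad_compat).cocycles 1).subtype ≤ LinearMap.range Φ := by
      rintro g ⟨z, hz, rfl⟩
      obtain ⟨c, hc⟩ := typeOne_eq_smul_of h3j h6g h6k ρK ρ𝔤 h hδ hf₀t hd₀ hz₀0 ((hmemZ z).1 hz)
      refine ⟨c, ?_⟩
      rw [LinearMap.restrictScalars_apply, LinearMap.toSpanSingleton_apply, Submodule.coe_subtype]
      exact hc.symm
    have h2 : Module.finrank ℝ ↥(LinearMap.range Φ) ≤ 2 :=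
      (LinearMap.finrank_range_le Φ).trans_eq Complex.finrank_real_complex
    haveI : Module.Finite ℝ ↥(Z.map ((gkComplex (uFormGroup (Fin 2) (Fin 1)) ρK ρ𝔤 h.gk.ad_compat).cocycles 1).subtype) := Submodule.finiteDimensional_of_le hle
    have e : ↥Z ≃ₗ[ℝ] ↥(Z.map ((gkComplex (uFormGroup (Fin 2) (Fin 1)) ρK ρ𝔤 h.gk.ad_compat).cocycles 1).subtype) :=
      Submodule.equivMapOfInjective _ (Submodule.injective_subtype _) Z
    exact ⟨Module.Finite.equiv e.symm, (LinearEquiv.finrank_eq e).trans_le ((Submodule.finrank_mono hle).trans h2)⟩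
  · -- no non-zero type-`δ` cocycle with `δ = ±1`: `Z = ⊥` (for `δ² ≠ 1` by `typeOne_eq_zero_of_sq_ne_one`)
    have hZ0 : Z = ⊥ := by
      rw [Submodule.eq_bot_iff]
      intro z hz
      by_contra hz0
      have hz0' : (z : Cochain ℝ (uFormGroup (Fin 2) (Fin 1)).lie (GKCarrier (uFormGroup (Fin 2) (Fin 1)) ρ𝔤) 1) ≠ 0 := fun h0 => hz0 (Subtype.ext h0)
      have hsq : δ * δ = 1 := by
        by_contra hsq
        exact hz0' (typeOne_eq_zero_of_sq_ne_one ρK ρ𝔤 h.gk.ad_compat hsq ((hmemZ z).1 hz))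
      exact hex ⟨z, hz, hz0', Int.eq_one_or_neg_one_of_mul_eq_one hsq⟩
    rw [hZ0]
    exact ⟨inferInstance, by rw [finrank_bot]; norm_num⟩

/-- **T6a holds** (from ★ T3j + ★ T6g). [cite: Rogawski1990, Prop. 15.2.1 (b)] [cite: BorelWallach2000, VI Thm. 4.11] -/
theorem stub_T6a_degOneTypePure : StubT6aDegOneTypePure :=
  t6a_of stub_T3j_cocycleValuesPNull stub_T6g_pNullGeneration

/-- T6b holds modulo the edition-2 stub T6g (was a stub in edition 1; T3j is ★, T6k is ★ since ed. 2.2). [cite: Rogawski1990, Prop. 15.2.1 (b)] -/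
theorem stub_T6b_degOneTypeFinrank : StubT6bDegOneTypeFinrank :=
  t6b_of stub_T3j_cocycleValuesPNull stub_T6g_pNullGeneration stub_T6k_u21PGeometry

/-- T6c holds modulo the edition-2 stub T6r (was a stub in edition 1; T3j is ★, T6k is ★ since ed. 2.2). [cite: Rogawski1990, Prop. 15.2.1 (b)] -/
theorem stub_T6c_degOneTypeRigid : StubT6cDegOneTypeRigid :=
  t6c_of stub_T3j_cocycleValuesPNull stub_T6k_u21PGeometry stub_T6r_pNullRigidity

end T6abc

/-! ## §4 The package and its consumers (VERBATIM) -/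

section Compositions

/-- The package from its six conjuncts. [cite: Rogawski1990, Prop. 15.2.1 (b)] -/
theorem archDegOnePackage_holds_of (h6a : StubT6aDegOneTypePure) (h6b : StubT6bDegOneTypeFinrank)
    (h6c : StubT6cDegOneTypeRigid) (h6d : StubT6dAdmissibleBridge) (h6e : StubT6eCasimirScalar)
    (h3j : StubT3jCocycleValuesPNull) : ArchDegOnePackage :=
  ⟨h6a, h6b, h6c, h6d, h6e, h3j⟩

/-- **The T6 package holds** (all six conjuncts are theorems of this file). [cite: Rogawski1990, Prop. 15.2.1 (b)] [cite: BorelWallach2000, VI Thm. 4.11] -/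
theorem archDegOnePackage_holds : ArchDegOnePackage :=
  archDegOnePackage_holds_of stub_T6a_degOneTypePure stub_T6b_degOneTypeFinrank stub_T6c_degOneTypeRigid
    stub_T6d_admissibleBridge stub_T6e_casimirScalar stub_T3j_cocycleValuesPNull

/-- **Edition-2 registry head**: the T6 package from the FOUR edition-2 stubs T6d, T6g, T6r, T6k (T6e, T3j are ★;
T6a ∕ T6b ∕ T6c are derived). [cite: Rogawski1990, Prop. 15.2.1 (b); BorelWallach2000, VI Thm. 4.11] -/
theorem archDegOnePackage_holds_of_ed2 (h6d : StubT6dAdmissibleBridge) (h6g : StubT6gPNullGeneration)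
    (h6r : StubT6rPNullRigidity) (h6k : StubT6kU21PGeometry) : ArchDegOnePackage :=
  archDegOnePackage_holds_of (t6a_of stub_T3j_cocycleValuesPNull h6g) (t6b_of stub_T3j_cocycleValuesPNull h6g h6k)
    (t6c_of stub_T3j_cocycleValuesPNull h6k h6r) h6d stub_T6e_casimirScalar stub_T3j_cocycleValuesPNull

/-- **BW II 3.4 (1) for the tree's admissible `(𝔤, K)`-modules of `U(α, β)`, DERIVED from T6d and the ★ theorem
`moduleFinite_gkComplex_carrier_of_isKAdmissible`**: every cochain space `C^q(𝔲(α,β), K; V)` is finite-dimensional.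
[cite: BorelWallach2000, II Prop. 3.4 (1)] -/
theorem cochainsFinite_of_T6d (h6d : StubT6dAdmissibleBridge) {α β : Type} [Fintype α] [DecidableEq α] [Fintype β]
    [DecidableEq β] {V : Type} [AddCommGroup V] [Module ℂ V]
    (ρK : Representation ℂ (uFormGroup α β).maximalCompact V) (ρ𝔤 : (uFormGroup α β).lie →ₗ⁅ℝ⁆ Module.End ℂ V)
    (hGK : IsGKModule (uFormGroup α β) ρK ρ𝔤) (hadm : IsAdmissibleGK ρK) (q : ℕ) :
    Module.Finite ℝ ↥((gkComplex (uFormGroup α β) ρK ρ𝔤 hGK.ad_compat).carrier q) :=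
  moduleFinite_gkComplex_carrier_of_isKAdmissible (uFormGroup α β) ρK ρ𝔤 hGK.ad_compat (h6d α β V ρK ρ𝔤 hGK hadm) q

variable {V : Type} [AddCommGroup V] [Module ℂ V]
  (ρK : Representation ℂ (uFormGroup (Fin 2) (Fin 1)).maximalCompact V)
  (ρ𝔤 : (uFormGroup (Fin 2) (Fin 1)).lie →ₗ⁅ℝ⁆ Module.End ℂ V)

/-- **E2′-shaped consequence (Hodge-type exclusion at the archimedean place)**: no irreducible unitary
`(𝔤, K)`-module of `U(2,1)` has both a non-zero `(1,0)`-class and a non-zero `(0,1)`-class — the local reason a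
holomorphic and an antiholomorphic cotangent form cannot generate the same `π_∞`. [cite: Rogawski1990, §15.3 ¶1] -/
theorem not_both_types_of_T6a (h6a : StubT6aDegOneTypePure) (h : IsCohUnitaryIrrep ρK ρ𝔤) :
    ¬ (upqTypeClasses ρK ρ𝔤 h.gk.ad_compat 1 1 ≠ ⊥ ∧ upqTypeClasses ρK ρ𝔤 h.gk.ad_compat 1 (-1) ≠ ⊥) := by
  rintro ⟨h1, h2⟩
  rcases h6a V ρK ρ𝔤 h with h0 | h0
  · exact h1 h0
  · exact h2 h0

/-- **E1′-shaped consequence (one class per type)**: two irreducible unitary `(𝔤, K)`-modules of `U(2,1)` with a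
non-zero `(1,0)`-class are equivalent — the archimedean component of a holomorphic-cotangent cohomological form is
pinned. [cite: Rogawski1990, Prop. 15.2.1 (b)] -/
theorem holType_equivalent_of_T6c (h6c : StubT6cDegOneTypeRigid) (h : IsCohUnitaryIrrep ρK ρ𝔤)
    {V' : Type} [AddCommGroup V'] [Module ℂ V']
    (ρK' : Representation ℂ (uFormGroup (Fin 2) (Fin 1)).maximalCompact V')
    (ρ𝔤' : (uFormGroup (Fin 2) (Fin 1)).lie →ₗ⁅ℝ⁆ Module.End ℂ V') (h' : IsCohUnitaryIrrep ρK' ρ𝔤')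
    (hV : upqTypeClasses ρK ρ𝔤 h.gk.ad_compat 1 1 ≠ ⊥) (hV' : upqTypeClasses ρK' ρ𝔤' h'.gk.ad_compat 1 1 ≠ ⊥) :
    AreGKEquivalent ρK ρ𝔤 ρK' ρ𝔤' :=
  h6c V ρK ρ𝔤 h V' ρK' ρ𝔤' h' 1 (Or.inl rfl) hV hV'

/-- **Rogawski 15.2.1 (b), dimension clause, DERIVED**: for an irreducible unitary `(𝔤, K)`-module of `U(2,1)`,
`dim_ℝ H¹(𝔤, K; V) ≤ 2` (`dim_ℂ ≤ 1`) — from T6d (finite cochains) the tree's II 4.5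
`upq_finrank_gkCohomology_eq_sum_typeClasses` gives `dim H¹ = dim H¹_{−1} + dim H¹_{+1}`, T6a kills one summand and
T6b bounds the other. [cite: Rogawski1990, Prop. 15.2.1 (b); BorelWallach2000, II Cor. 4.5] -/
theorem finrank_H1_le_two_of (h6a : StubT6aDegOneTypePure) (h6b : StubT6bDegOneTypeFinrank)
    (h6d : StubT6dAdmissibleBridge) (h : IsCohUnitaryIrrep ρK ρ𝔤) :
    Module.finrank ℝ (gkCohomology (uFormGroup (Fin 2) (Fin 1)) ρK ρ𝔤 h.gk.ad_compat 1) ≤ 2 := by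
  obtain ⟨B, hBs, hB, hBd, hadj, hBz, hBI⟩ := h.unit
  haveI : Module.Finite ℝ ↥((gkComplex (uFormGroup (Fin 2) (Fin 1)) ρK ρ𝔤 h.gk.ad_compat).carrier (0 + 1)) :=
    cochainsFinite_of_T6d h6d ρK ρ𝔤 h.gk h.adm 1
  have hsum := upq_finrank_gkCohomology_eq_sum_typeClasses ρK ρ𝔤 h.gk.ad_compat hBs hB hBd hadj hBz hBI 0
  have e1 : Module.finrank ℝ (gkCohomology (uFormGroup (Fin 2) (Fin 1)) ρK ρ𝔤 h.gk.ad_compat 1) =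
      Module.finrank ℝ ↥(upqTypeClasses ρK ρ𝔤 h.gk.ad_compat 1 (-1)) +
        Module.finrank ℝ ↥(upqTypeClasses ρK ρ𝔤 h.gk.ad_compat 1 1) := by
    have h' := hsum
    simp [Fin.sum_univ_two] at h'
    convert h' using 2 <;> rfl
  rw [e1]
  rcases h6a V ρK ρ𝔤 h with h0 | h0
  · rw [h0, finrank_bot, add_zero]
    exact (h6b V ρK ρ𝔤 h (-1)).2
  · rw [h0, finrank_bot, zero_add]
    exact (h6b V ρK ρ𝔤 h 1).2

end Compositions

end Summit.HodgeConjecture.HodgeConjecture.Cruxes.H413.F0P3bArchDegOnePackage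

end
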